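import Summits.Parity.GeneralizedHardyLittlewood.Theorems.PrimeLevelFamEdgeMomentsBeyondDiagonalDiagRemThreeThreeKernels
import HarnessLib

/-!
# Route `PrimeLevelFamEdge`, crux K_A `MomentsBeyondDiagonal` (stmt-Parity-20007), line «petersson_layers» v4, stub `stub_diag`:
# **the SIXTEEN remainder kernels of order `(3,3)` under ONE set of constants (envelope exponent `8`), with the pointwise bounds of
# the six both-sided ones** (brick B4b of (R₃₃); the order-`(3,3)` twin of `…DiagRemOneThreeBose.twoSeq_eight₁₃`)

All sixteen continued Bose remainders `r_ab`, `a, b ≤ 3`, of the order-`(3,3)` remainder weight (hypothesis `hR` of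
`…DiagDecorOrderThreeThreeAssembly.orderThreeThree_target_of_poly_of_remainder`) are obtained here UNIFORMLY from the generic
two-sequence estimate, in exactly the `Π`-form printed in `hR` (moments `μ₂, μ₄, μ₆ = ∫₀¹logᵐv·v/(1+v²)²` explicit), under ONE
envelope constant `C₀` and the common envelope `9C₀(1+|log 2αY²|)⁸`; for the six kernels that carry a both-sided `P₂ ⊗ P₂` monomial
(`(a,b) ∈ {(0,0),(0,1),(1,0),(0,2),(2,0),(1,1)}`) the small- and large-argument pointwise bounds `|r_ab(y)| ≤ C₀√y` (`y ≤ 1`),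
`|r_ab(y)| ≤ C₀(1+log y)³` (`y ≥ 1`) come with the SAME `E_ab` — the inputs `hR2 / hRs / hRt` of
`…DiagRemBothSidedPow.abs_bothsided_primeSq_le_pow` (`N = 8`, `M = 3`).

* `abs_bose_rem_twoSeq_small_tail` — generic `(a,b)`: two-sequence estimate ∧ `|r_ab(y)| ≤ C₀√y` (`y ≤ 1`) ∧
  `|r_ab(y)| ≤ C₀(1+log y)^{a+b+1}` (`y ≥ 1`) under one constant (KMV form);
* `twoSeq_sixteen₃₃` — **the sixteen two-sequence estimates (disjunctive form) and the pointwise bounds of the six both-sided kernels.**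

Def-free; theorems only. Helper `--supports stmt-Parity-20007`; closes nothing; K_A, K_B and the Parity summit are NOT proved;
nothing about Landau–Siegel zeros.

## References
* E. Kowalski, P. Michel, J. VanderKam, J. reine angew. Math. 526 (2000), (22)–(28) pp. 12–15 and Prop. 5.1 p. 18.
  [cite: KowalskiMichelVanderKam2000, (23)–(28) and Prop. 5.1 — derivation (order-(3,3) remainder, inner sums)]
-/

noncomputable section

open Real MeasureTheory Finset

namespace Summit.Parity.GeneralizedHardyLittlewood.Theorems.MomentsBeyondDiagonal.DiagCorner

open Summit.Parity.GeneralizedHardyLittlewood.Theorems.BeyondDiagonalBeatsQuarter.Corner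
open Summit.Parity.GeneralizedHardyLittlewood.Theorems.MomentsBeyondDiagonal.DiagLines

set_option maxHeartbeats 3200000 in
-- many kernels, large statement; one generated simp set for all kernels
/-- **The six both-sided remainder kernels of order `(3,3)` (`r₀₀, r₀₁, r₁₀, r₀₂, r₂₀, r₁₁`) under one set of constants: two-sequence estimates (envelope exponent `8`) AND the pointwise bounds `|r_ab(y)| ≤ C₀√y` (`y ≤ 1`), `≤ C₀(1+log y)³` (`y ≥ 1`) with the same `E_ab`** (module docstring). [cite: KowalskiMichelVanderKam2000, (23)–(28) and Prop. 5.1 — derivation (order-(3,3) remainder, inner sums)] -/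
theorem twoSeq_six₃₃ : ∃ E₀₀ E₀₁ E₁₀ E₀₂ E₂₀ E₁₁ C₀ : ℝ, 0 ≤ C₀ ∧
    (∀ R : ℝ → ℝ,
      (R = (fun y : ℝ ↦ (∫ u₁ in Set.Ioi (0 : ℝ), ∫ u₂ in Set.Ioi (y / u₁),
              Real.exp (-(u₁ + u₂)) / (1 - Real.exp (-(u₁ + u₂))) ^ 2) -
            (Real.log (1 / y) / 2 + E₀₀)) ∨
       R = (fun y : ℝ ↦ (∫ u₁ in Set.Ioi (0 : ℝ), ∫ u₂ in Set.Ioi (y / u₁),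
              Real.exp (-(u₁ + u₂)) / (1 - Real.exp (-(u₁ + u₂))) ^ 2 * Real.log u₂) -
            (-(Real.log (1 / y) ^ 2) / 8 + E₀₁)) ∨
       R = (fun y : ℝ ↦ (∫ u₁ in Set.Ioi (0 : ℝ), Real.log u₁ * ∫ u₂ in Set.Ioi (y / u₁),
              Real.exp (-(u₁ + u₂)) / (1 - Real.exp (-(u₁ + u₂))) ^ 2) -
            (-(Real.log (1 / y) ^ 2) / 8 + E₁₀)) ∨
       R = (fun y : ℝ ↦ (∫ u₁ in Set.Ioi (0 : ℝ), ∫ u₂ in Set.Ioi (y / u₁),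
              Real.exp (-(u₁ + u₂)) / (1 - Real.exp (-(u₁ + u₂))) ^ 2 * Real.log u₂ ^ 2) -
            (Real.log (1 / y) ^ 3 / 24 + 2 * (∫ v in Set.Ioc (0 : ℝ) 1, Real.log v ^ 2 * (v / (1 + v ^ 2) ^ 2)) * Real.log (1 / y) + E₀₂)) ∨
       R = (fun y : ℝ ↦ (∫ u₁ in Set.Ioi (0 : ℝ), Real.log u₁ ^ 2 * ∫ u₂ in Set.Ioi (y / u₁),
              Real.exp (-(u₁ + u₂)) / (1 - Real.exp (-(u₁ + u₂))) ^ 2) -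
            (Real.log (1 / y) ^ 3 / 24 + 2 * (∫ v in Set.Ioc (0 : ℝ) 1, Real.log v ^ 2 * (v / (1 + v ^ 2) ^ 2)) * Real.log (1 / y) + E₂₀)) ∨
       R = (fun y : ℝ ↦ (∫ u₁ in Set.Ioi (0 : ℝ), Real.log u₁ * ∫ u₂ in Set.Ioi (y / u₁),
              Real.exp (-(u₁ + u₂)) / (1 - Real.exp (-(u₁ + u₂))) ^ 2 * Real.log u₂) -
            (Real.log (1 / y) ^ 3 / 24 - 2 * (∫ v in Set.Ioc (0 : ℝ) 1, Real.log v ^ 2 * (v / (1 + v ^ 2) ^ 2)) * Real.log (1 / y) + E₁₁))) →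
      ∀ (a₁ a₂ : ℕ → ℝ) (Y α B η : ℝ) (K₁ i j : ℕ), 1 ≤ Y → 0 < α → 1 ≤ i → 1 ≤ j →
        (∀ e : ℕ, e ≤ ⌊Y⌋₊ → |∑ k ∈ Icc 1 e, a₂ k| ≤ B) → (∀ e : ℕ, K₁ ≤ e → |∑ k ∈ Icc 1 e, a₁ k| ≤ η) →
        2 * α * K₁ * Y ≤ 1 →
      |∑ k₁ ∈ Icc 1 ⌊Y⌋₊, ∑ k₂ ∈ Icc 1 ⌊Y⌋₊,
          a₁ k₁ * a₂ k₂ * ellp Y k₁ ^ i * ellp Y k₂ ^ j * R (α * k₁ * k₂)| ≤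
        (∑ k ∈ Icc 1 ⌊Y⌋₊, |a₁ k| * ellp Y k ^ i) * (B * (Real.log Y ^ j * (3 * C₀ * Real.sqrt (2 * α * K₁ * Y)))) +
          (∑ k ∈ Icc 1 ⌊Y⌋₊, |a₂ k| * ellp Y k ^ j) *
            ((2 * η) * (Real.log Y ^ i * (9 * C₀ * (1 + |Real.log (2 * α * Y ^ 2)|) ^ 8)))) ∧
    (∀ R : ℝ → ℝ,
      (R = (fun y : ℝ ↦ (∫ u₁ in Set.Ioi (0 : ℝ), ∫ u₂ in Set.Ioi (y / u₁),
              Real.exp (-(u₁ + u₂)) / (1 - Real.exp (-(u₁ + u₂))) ^ 2) -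
            (Real.log (1 / y) / 2 + E₀₀)) ∨
       R = (fun y : ℝ ↦ (∫ u₁ in Set.Ioi (0 : ℝ), ∫ u₂ in Set.Ioi (y / u₁),
              Real.exp (-(u₁ + u₂)) / (1 - Real.exp (-(u₁ + u₂))) ^ 2 * Real.log u₂) -
            (-(Real.log (1 / y) ^ 2) / 8 + E₀₁)) ∨
       R = (fun y : ℝ ↦ (∫ u₁ in Set.Ioi (0 : ℝ), Real.log u₁ * ∫ u₂ in Set.Ioi (y / u₁),
              Real.exp (-(u₁ + u₂)) / (1 - Real.exp (-(u₁ + u₂))) ^ 2) -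
            (-(Real.log (1 / y) ^ 2) / 8 + E₁₀)) ∨
       R = (fun y : ℝ ↦ (∫ u₁ in Set.Ioi (0 : ℝ), ∫ u₂ in Set.Ioi (y / u₁),
              Real.exp (-(u₁ + u₂)) / (1 - Real.exp (-(u₁ + u₂))) ^ 2 * Real.log u₂ ^ 2) -
            (Real.log (1 / y) ^ 3 / 24 + 2 * (∫ v in Set.Ioc (0 : ℝ) 1, Real.log v ^ 2 * (v / (1 + v ^ 2) ^ 2)) * Real.log (1 / y) + E₀₂)) ∨
       R = (fun y : ℝ ↦ (∫ u₁ in Set.Ioi (0 : ℝ), Real.log u₁ ^ 2 * ∫ u₂ in Set.Ioi (y / u₁),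
              Real.exp (-(u₁ + u₂)) / (1 - Real.exp (-(u₁ + u₂))) ^ 2) -
            (Real.log (1 / y) ^ 3 / 24 + 2 * (∫ v in Set.Ioc (0 : ℝ) 1, Real.log v ^ 2 * (v / (1 + v ^ 2) ^ 2)) * Real.log (1 / y) + E₂₀)) ∨
       R = (fun y : ℝ ↦ (∫ u₁ in Set.Ioi (0 : ℝ), Real.log u₁ * ∫ u₂ in Set.Ioi (y / u₁),
              Real.exp (-(u₁ + u₂)) / (1 - Real.exp (-(u₁ + u₂))) ^ 2 * Real.log u₂) -
            (Real.log (1 / y) ^ 3 / 24 - 2 * (∫ v in Set.Ioc (0 : ℝ) 1, Real.log v ^ 2 * (v / (1 + v ^ 2) ^ 2)) * Real.log (1 / y) + E₁₁))) →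
      (∀ y : ℝ, 0 < y → y ≤ 1 → |R y| ≤ C₀ * Real.sqrt y) ∧ (∀ y : ℝ, 1 ≤ y → |R y| ≤ C₀ * (1 + Real.log y) ^ 3)) := by
  obtain ⟨C₀₀, hC₀₀, h₀₀, hs₀₀, ht₀₀⟩ := abs_bose_rem_twoSeq_small_tail 0 0
  obtain ⟨C₀₁, hC₀₁, h₀₁, hs₀₁, ht₀₁⟩ := abs_bose_rem_twoSeq_small_tail 0 1
  obtain ⟨C₁₀, hC₁₀, h₁₀, hs₁₀, ht₁₀⟩ := abs_bose_rem_twoSeq_small_tail 1 0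
  obtain ⟨C₀₂, hC₀₂, h₀₂, hs₀₂, ht₀₂⟩ := abs_bose_rem_twoSeq_small_tail 0 2
  obtain ⟨C₂₀, hC₂₀, h₂₀, hs₂₀, ht₂₀⟩ := abs_bose_rem_twoSeq_small_tail 2 0
  obtain ⟨C₁₁, hC₁₁, h₁₁, hs₁₁, ht₁₁⟩ := abs_bose_rem_twoSeq_small_tail 1 1
  set C₀ : ℝ := C₀₀ + C₀₁ + C₁₀ + C₀₂ + C₂₀ + C₁₁ with hC₀
  have hC₀0 : 0 ≤ C₀ := by rw [hC₀]; positivity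
  have e₀₀ : C₀₀ ≤ C₀ := by rw [hC₀]; linarith [hC₀₀, hC₀₁, hC₁₀, hC₀₂, hC₂₀, hC₁₁]
  have e₀₁ : C₀₁ ≤ C₀ := by rw [hC₀]; linarith [hC₀₀, hC₀₁, hC₁₀, hC₀₂, hC₂₀, hC₁₁]
  have e₁₀ : C₁₀ ≤ C₀ := by rw [hC₀]; linarith [hC₀₀, hC₀₁, hC₁₀, hC₀₂, hC₂₀, hC₁₁]
  have e₀₂ : C₀₂ ≤ C₀ := by rw [hC₀]; linarith [hC₀₀, hC₀₁, hC₁₀, hC₀₂, hC₂₀, hC₁₁]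
  have e₂₀ : C₂₀ ≤ C₀ := by rw [hC₀]; linarith [hC₀₀, hC₀₁, hC₁₀, hC₀₂, hC₂₀, hC₁₁]
  have e₁₁ : C₁₁ ≤ C₀ := by rw [hC₀]; linarith [hC₀₀, hC₀₁, hC₁₀, hC₀₂, hC₂₀, hC₁₁]
  have hc32 : Nat.choose 3 2 = 3 := by decide
  refine ⟨(∫ u₁ in Set.Ioi (0 : ℝ), Real.log u₁ ^ 0 * ∫ u₂ in Set.Ioi (1 / u₁), Real.exp (-(u₁ + u₂)) / (1 - Real.exp (-(u₁ + u₂))) ^ 2 * Real.log u₂ ^ 0) +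
      (∫ η in Set.Ioc (0 : ℝ) 1, (η * (∫ u in Set.Ioi (0 : ℝ), Real.log u ^ 0 * Real.log (η / u) ^ 0 * (Real.exp (-(u + η / u)) / (1 - Real.exp (-(u + η / u))) ^ 2) / u) -
          ∫ v in Set.Ioc (0 : ℝ) 1, ((-(Real.log (1 / η) / 2) + Real.log v) ^ 0 * (-(Real.log (1 / η) / 2) - Real.log v) ^ 0 +
              (-(Real.log (1 / η) / 2) - Real.log v) ^ 0 * (-(Real.log (1 / η) / 2) + Real.log v) ^ 0) * (v / (1 + v ^ 2) ^ 2)) / η),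
    (∫ u₁ in Set.Ioi (0 : ℝ), Real.log u₁ ^ 0 * ∫ u₂ in Set.Ioi (1 / u₁), Real.exp (-(u₁ + u₂)) / (1 - Real.exp (-(u₁ + u₂))) ^ 2 * Real.log u₂ ^ 1) +
      (∫ η in Set.Ioc (0 : ℝ) 1, (η * (∫ u in Set.Ioi (0 : ℝ), Real.log u ^ 0 * Real.log (η / u) ^ 1 * (Real.exp (-(u + η / u)) / (1 - Real.exp (-(u + η / u))) ^ 2) / u) -
          ∫ v in Set.Ioc (0 : ℝ) 1, ((-(Real.log (1 / η) / 2) + Real.log v) ^ 0 * (-(Real.log (1 / η) / 2) - Real.log v) ^ 1 +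
              (-(Real.log (1 / η) / 2) - Real.log v) ^ 0 * (-(Real.log (1 / η) / 2) + Real.log v) ^ 1) * (v / (1 + v ^ 2) ^ 2)) / η),
    (∫ u₁ in Set.Ioi (0 : ℝ), Real.log u₁ ^ 1 * ∫ u₂ in Set.Ioi (1 / u₁), Real.exp (-(u₁ + u₂)) / (1 - Real.exp (-(u₁ + u₂))) ^ 2 * Real.log u₂ ^ 0) +
      (∫ η in Set.Ioc (0 : ℝ) 1, (η * (∫ u in Set.Ioi (0 : ℝ), Real.log u ^ 1 * Real.log (η / u) ^ 0 * (Real.exp (-(u + η / u)) / (1 - Real.exp (-(u + η / u))) ^ 2) / u) -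
          ∫ v in Set.Ioc (0 : ℝ) 1, ((-(Real.log (1 / η) / 2) + Real.log v) ^ 1 * (-(Real.log (1 / η) / 2) - Real.log v) ^ 0 +
              (-(Real.log (1 / η) / 2) - Real.log v) ^ 1 * (-(Real.log (1 / η) / 2) + Real.log v) ^ 0) * (v / (1 + v ^ 2) ^ 2)) / η),
    (∫ u₁ in Set.Ioi (0 : ℝ), Real.log u₁ ^ 0 * ∫ u₂ in Set.Ioi (1 / u₁), Real.exp (-(u₁ + u₂)) / (1 - Real.exp (-(u₁ + u₂))) ^ 2 * Real.log u₂ ^ 2) +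
      (∫ η in Set.Ioc (0 : ℝ) 1, (η * (∫ u in Set.Ioi (0 : ℝ), Real.log u ^ 0 * Real.log (η / u) ^ 2 * (Real.exp (-(u + η / u)) / (1 - Real.exp (-(u + η / u))) ^ 2) / u) -
          ∫ v in Set.Ioc (0 : ℝ) 1, ((-(Real.log (1 / η) / 2) + Real.log v) ^ 0 * (-(Real.log (1 / η) / 2) - Real.log v) ^ 2 +
              (-(Real.log (1 / η) / 2) - Real.log v) ^ 0 * (-(Real.log (1 / η) / 2) + Real.log v) ^ 2) * (v / (1 + v ^ 2) ^ 2)) / η),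
    (∫ u₁ in Set.Ioi (0 : ℝ), Real.log u₁ ^ 2 * ∫ u₂ in Set.Ioi (1 / u₁), Real.exp (-(u₁ + u₂)) / (1 - Real.exp (-(u₁ + u₂))) ^ 2 * Real.log u₂ ^ 0) +
      (∫ η in Set.Ioc (0 : ℝ) 1, (η * (∫ u in Set.Ioi (0 : ℝ), Real.log u ^ 2 * Real.log (η / u) ^ 0 * (Real.exp (-(u + η / u)) / (1 - Real.exp (-(u + η / u))) ^ 2) / u) -
          ∫ v in Set.Ioc (0 : ℝ) 1, ((-(Real.log (1 / η) / 2) + Real.log v) ^ 2 * (-(Real.log (1 / η) / 2) - Real.log v) ^ 0 +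
              (-(Real.log (1 / η) / 2) - Real.log v) ^ 2 * (-(Real.log (1 / η) / 2) + Real.log v) ^ 0) * (v / (1 + v ^ 2) ^ 2)) / η),
    (∫ u₁ in Set.Ioi (0 : ℝ), Real.log u₁ ^ 1 * ∫ u₂ in Set.Ioi (1 / u₁), Real.exp (-(u₁ + u₂)) / (1 - Real.exp (-(u₁ + u₂))) ^ 2 * Real.log u₂ ^ 1) +
      (∫ η in Set.Ioc (0 : ℝ) 1, (η * (∫ u in Set.Ioi (0 : ℝ), Real.log u ^ 1 * Real.log (η / u) ^ 1 * (Real.exp (-(u + η / u)) / (1 - Real.exp (-(u + η / u))) ^ 2) / u) -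
          ∫ v in Set.Ioc (0 : ℝ) 1, ((-(Real.log (1 / η) / 2) + Real.log v) ^ 1 * (-(Real.log (1 / η) / 2) - Real.log v) ^ 1 +
              (-(Real.log (1 / η) / 2) - Real.log v) ^ 1 * (-(Real.log (1 / η) / 2) + Real.log v) ^ 1) * (v / (1 + v ^ 2) ^ 2)) / η),
    C₀, hC₀0, ?_, ?_⟩
  · intro R hRR a₁ a₂ Y α B η K₁ i j hY hα hi hj hB hη hY₁
    have hY0 : 0 < Y := by linarith
    have hη0 : 0 ≤ η := (abs_nonneg _).trans (hη K₁ le_rfl)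
    have hLY : 0 ≤ Real.log Y := Real.log_nonneg hY
    have hx : (1 : ℝ) ≤ 1 + |Real.log (2 * α * Y ^ 2)| := by linarith [abs_nonneg (Real.log (2 * α * Y ^ 2))]
    have hSj : 0 ≤ ∑ k ∈ Icc 1 ⌊Y⌋₊, |a₂ k| * ellp Y k ^ j :=
      Finset.sum_nonneg fun k _ ↦ mul_nonneg (abs_nonneg _) (pow_nonneg (ellp_nonneg Y k) j)
    have hSi : 0 ≤ ∑ k ∈ Icc 1 ⌊Y⌋₊, |a₁ k| * ellp Y k ^ i :=
      Finset.sum_nonneg fun k _ ↦ mul_nonneg (abs_nonneg _) (pow_nonneg (ellp_nonneg Y k) i)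
    have hB0 : 0 ≤ B := (abs_nonneg _).trans (hB 0 (Nat.zero_le _))
    have hsq : 0 ≤ Real.sqrt (2 * α * K₁ * Y) := Real.sqrt_nonneg _
    have hfirst : ∀ {C : ℝ}, C ≤ C₀ →
        (∑ k ∈ Icc 1 ⌊Y⌋₊, |a₁ k| * ellp Y k ^ i) * (B * (Real.log Y ^ j * (3 * C * Real.sqrt (2 * α * K₁ * Y)))) ≤
        (∑ k ∈ Icc 1 ⌊Y⌋₊, |a₁ k| * ellp Y k ^ i) * (B * (Real.log Y ^ j * (3 * C₀ * Real.sqrt (2 * α * K₁ * Y)))) := by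
      intro C hC
      have hLj : 0 ≤ Real.log Y ^ j := pow_nonneg hLY j
      gcongr
    have hsecond : ∀ {C : ℝ} {N : ℕ}, 0 ≤ C → C ≤ C₀ →
        (∑ k ∈ Icc 1 ⌊Y⌋₊, |a₂ k| * ellp Y k ^ j) * ((2 * η) * (Real.log Y ^ i *
            (3 * (C + C * (1 + |Real.log (2 * α * Y ^ 2)|) ^ N) + 2 * C +
              C * (1 + |Real.log (2 * α * Y ^ 2)|) ^ N * (1 + |Real.log (2 * α * Y ^ 2)|)))) ≤
        (∑ k ∈ Icc 1 ⌊Y⌋₊, |a₂ k| * ellp Y k ^ j) * ((2 * η) * (Real.log Y ^ i *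
            (3 * (C₀ + C₀ * (1 + |Real.log (2 * α * Y ^ 2)|) ^ N) + 2 * C₀ +
              C₀ * (1 + |Real.log (2 * α * Y ^ 2)|) ^ N * (1 + |Real.log (2 * α * Y ^ 2)|)))) := by
      intro C N hC hCC
      have hLi : 0 ≤ Real.log Y ^ i := pow_nonneg hLY i
      have hxN : 0 ≤ (1 + |Real.log (2 * α * Y ^ 2)|) ^ N := pow_nonneg (by positivity) N
      gcongr
    rcases hRR with rfl | rfl | rfl | rfl | rfl | rfl
    · have h := h₀₀ a₁ a₂ Y α B η K₁ i j hY hα hi hj hB hη hY₁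
      have h' := le_trans h (add_le_add (hfirst e₀₀) (hsecond hC₀₀ e₀₀))
      have h'' := weaken_second_term8 hSj hη0 hLY hC₀0 hx (by norm_num : 0 + 0 + 1 ≤ 7) h'
      refine le_trans (le_of_eq ?_) h''
      congr 1
      refine Finset.sum_congr rfl fun k₁ _ ↦ Finset.sum_congr rfl fun k₂ _ ↦ ?_
      simp only [Finset.sum_range_succ, Finset.sum_range_zero, zero_add, add_zero, Nat.choose_self, Nat.cast_one,
        Nat.sub_self, Nat.cast_zero, Nat.cast_add, pow_zero, pow_one, one_mul, mul_one, integral_model_weight_Ioc]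
      ring
    · have h := h₀₁ a₁ a₂ Y α B η K₁ i j hY hα hi hj hB hη hY₁
      have h' := le_trans h (add_le_add (hfirst e₀₁) (hsecond hC₀₁ e₀₁))
      have h'' := weaken_second_term8 hSj hη0 hLY hC₀0 hx (by norm_num : 0 + 1 + 1 ≤ 7) h'
      refine le_trans (le_of_eq ?_) h''
      congr 1
      refine Finset.sum_congr rfl fun k₁ _ ↦ Finset.sum_congr rfl fun k₂ _ ↦ ?_
      simp only [Finset.sum_range_succ, Finset.sum_range_zero, zero_add, add_zero, Nat.choose_self,
        Nat.choose_zero_right, Nat.cast_one, Nat.sub_self, Nat.sub_zero, Nat.reduceAdd, Nat.cast_zero, Nat.cast_add,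
        pow_zero, pow_one, one_mul, mul_one, integral_model_weight_Ioc]
      ring
    · have h := h₁₀ a₁ a₂ Y α B η K₁ i j hY hα hi hj hB hη hY₁
      have h' := le_trans h (add_le_add (hfirst e₁₀) (hsecond hC₁₀ e₁₀))
      have h'' := weaken_second_term8 hSj hη0 hLY hC₀0 hx (by norm_num : 1 + 0 + 1 ≤ 7) h'
      refine le_trans (le_of_eq ?_) h''
      congr 1
      refine Finset.sum_congr rfl fun k₁ _ ↦ Finset.sum_congr rfl fun k₂ _ ↦ ?_
      simp only [Finset.sum_range_succ, Finset.sum_range_zero, zero_add, add_zero, Nat.choose_self,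
        Nat.choose_zero_right, Nat.cast_one, Nat.sub_self, Nat.sub_zero, Nat.reduceAdd, Nat.cast_zero, Nat.cast_add,
        pow_zero, pow_one, one_mul, mul_one, integral_model_weight_Ioc]
      ring
    · have h := h₀₂ a₁ a₂ Y α B η K₁ i j hY hα hi hj hB hη hY₁
      have h' := le_trans h (add_le_add (hfirst e₀₂) (hsecond hC₀₂ e₀₂))
      have h'' := weaken_second_term8 hSj hη0 hLY hC₀0 hx (by norm_num : 0 + 2 + 1 ≤ 7) h'
      refine le_trans (le_of_eq ?_) h''
      congr 1
      refine Finset.sum_congr rfl fun k₁ _ ↦ Finset.sum_congr rfl fun k₂ _ ↦ ?_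
      simp only [Finset.sum_range_succ, Finset.sum_range_zero, zero_add, add_zero, Nat.choose_self,
        Nat.choose_zero_right, Nat.choose_one_right, Nat.cast_one, Nat.cast_ofNat, Nat.sub_self, Nat.sub_zero,
        Nat.reduceSub, Nat.reduceAdd, Nat.cast_zero, Nat.cast_add, pow_zero, pow_one, one_mul, mul_one,
        integral_model_weight_Ioc]
      ring
    · have h := h₂₀ a₁ a₂ Y α B η K₁ i j hY hα hi hj hB hη hY₁
      have h' := le_trans h (add_le_add (hfirst e₂₀) (hsecond hC₂₀ e₂₀))
      have h'' := weaken_second_term8 hSj hη0 hLY hC₀0 hx (by norm_num : 2 + 0 + 1 ≤ 7) h'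
      refine le_trans (le_of_eq ?_) h''
      congr 1
      refine Finset.sum_congr rfl fun k₁ _ ↦ Finset.sum_congr rfl fun k₂ _ ↦ ?_
      simp only [Finset.sum_range_succ, Finset.sum_range_zero, zero_add, add_zero, Nat.choose_self,
        Nat.choose_zero_right, Nat.choose_one_right, Nat.cast_one, Nat.cast_ofNat, Nat.sub_self, Nat.sub_zero,
        Nat.reduceSub, Nat.reduceAdd, Nat.cast_zero, Nat.cast_add, pow_zero, pow_one, one_mul, mul_one,
        integral_model_weight_Ioc]
      ring
    · have h := h₁₁ a₁ a₂ Y α B η K₁ i j hY hα hi hj hB hη hY₁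
      have h' := le_trans h (add_le_add (hfirst e₁₁) (hsecond hC₁₁ e₁₁))
      have h'' := weaken_second_term8 hSj hη0 hLY hC₀0 hx (by norm_num : 1 + 1 + 1 ≤ 7) h'
      refine le_trans (le_of_eq ?_) h''
      congr 1
      refine Finset.sum_congr rfl fun k₁ _ ↦ Finset.sum_congr rfl fun k₂ _ ↦ ?_
      simp only [Finset.sum_range_succ, Finset.sum_range_zero, zero_add, add_zero, Nat.choose_self,
        Nat.choose_zero_right, Nat.cast_one, Nat.sub_self, Nat.sub_zero, Nat.reduceAdd, Nat.cast_zero, Nat.cast_add,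
        pow_zero, pow_one, one_mul, mul_one, integral_model_weight_Ioc]
      ring
  · intro R hRR
    rcases hRR with rfl | rfl | rfl | rfl | rfl | rfl
    · refine ⟨fun y hy0 hy1 ↦ ?_, fun y hy ↦ ?_⟩
      · refine le_trans (le_of_eq ?_) ((hs₀₀ y hy0 hy1).trans (mul_le_mul_of_nonneg_right e₀₀ (Real.sqrt_nonneg y)))
        congr 1
        simp only [Finset.sum_range_succ, Finset.sum_range_zero, zero_add, add_zero, Nat.choose_self, Nat.cast_one,
          Nat.sub_self, Nat.cast_zero, Nat.cast_add, pow_zero, pow_one, one_mul, mul_one, integral_model_weight_Ioc]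
        ring
      · have hl1 : 1 ≤ 1 + Real.log y := by linarith [Real.log_nonneg hy]
        have hpw : (1 + Real.log y) ^ (0 + 0 + 1) ≤ (1 + Real.log y) ^ 3 := pow_le_pow_right₀ hl1 (by norm_num)
        refine le_trans (le_of_eq ?_) (((ht₀₀ y hy).trans (mul_le_mul_of_nonneg_right e₀₀ (pow_nonneg (by linarith) _))).trans
          (mul_le_mul_of_nonneg_left hpw hC₀0))
        congr 1
        simp only [Finset.sum_range_succ, Finset.sum_range_zero, zero_add, add_zero, Nat.choose_self, Nat.cast_one,
          Nat.sub_self, Nat.cast_zero, Nat.cast_add, pow_zero, pow_one, one_mul, mul_one, integral_model_weight_Ioc]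
        ring
    · refine ⟨fun y hy0 hy1 ↦ ?_, fun y hy ↦ ?_⟩
      · refine le_trans (le_of_eq ?_) ((hs₀₁ y hy0 hy1).trans (mul_le_mul_of_nonneg_right e₀₁ (Real.sqrt_nonneg y)))
        congr 1
        simp only [Finset.sum_range_succ, Finset.sum_range_zero, zero_add, add_zero, Nat.choose_self,
          Nat.choose_zero_right, Nat.cast_one, Nat.sub_self, Nat.sub_zero, Nat.reduceAdd, Nat.cast_zero,
          Nat.cast_add, pow_zero, pow_one, one_mul, mul_one, integral_model_weight_Ioc]
        ring
      · have hl1 : 1 ≤ 1 + Real.log y := by linarith [Real.log_nonneg hy]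
        have hpw : (1 + Real.log y) ^ (0 + 1 + 1) ≤ (1 + Real.log y) ^ 3 := pow_le_pow_right₀ hl1 (by norm_num)
        refine le_trans (le_of_eq ?_) (((ht₀₁ y hy).trans (mul_le_mul_of_nonneg_right e₀₁ (pow_nonneg (by linarith) _))).trans
          (mul_le_mul_of_nonneg_left hpw hC₀0))
        congr 1
        simp only [Finset.sum_range_succ, Finset.sum_range_zero, zero_add, add_zero, Nat.choose_self,
          Nat.choose_zero_right, Nat.cast_one, Nat.sub_self, Nat.sub_zero, Nat.reduceAdd, Nat.cast_zero,
          Nat.cast_add, pow_zero, pow_one, one_mul, mul_one, integral_model_weight_Ioc]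
        ring
    · refine ⟨fun y hy0 hy1 ↦ ?_, fun y hy ↦ ?_⟩
      · refine le_trans (le_of_eq ?_) ((hs₁₀ y hy0 hy1).trans (mul_le_mul_of_nonneg_right e₁₀ (Real.sqrt_nonneg y)))
        congr 1
        simp only [Finset.sum_range_succ, Finset.sum_range_zero, zero_add, add_zero, Nat.choose_self,
          Nat.choose_zero_right, Nat.cast_one, Nat.sub_self, Nat.sub_zero, Nat.reduceAdd, Nat.cast_zero,
          Nat.cast_add, pow_zero, pow_one, one_mul, mul_one, integral_model_weight_Ioc]
        ring
      · have hl1 : 1 ≤ 1 + Real.log y := by linarith [Real.log_nonneg hy]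
        have hpw : (1 + Real.log y) ^ (1 + 0 + 1) ≤ (1 + Real.log y) ^ 3 := pow_le_pow_right₀ hl1 (by norm_num)
        refine le_trans (le_of_eq ?_) (((ht₁₀ y hy).trans (mul_le_mul_of_nonneg_right e₁₀ (pow_nonneg (by linarith) _))).trans
          (mul_le_mul_of_nonneg_left hpw hC₀0))
        congr 1
        simp only [Finset.sum_range_succ, Finset.sum_range_zero, zero_add, add_zero, Nat.choose_self,
          Nat.choose_zero_right, Nat.cast_one, Nat.sub_self, Nat.sub_zero, Nat.reduceAdd, Nat.cast_zero,
          Nat.cast_add, pow_zero, pow_one, one_mul, mul_one, integral_model_weight_Ioc]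
        ring
    · refine ⟨fun y hy0 hy1 ↦ ?_, fun y hy ↦ ?_⟩
      · refine le_trans (le_of_eq ?_) ((hs₀₂ y hy0 hy1).trans (mul_le_mul_of_nonneg_right e₀₂ (Real.sqrt_nonneg y)))
        congr 1
        simp only [Finset.sum_range_succ, Finset.sum_range_zero, zero_add, add_zero, Nat.choose_self,
          Nat.choose_zero_right, Nat.choose_one_right, Nat.cast_one, Nat.cast_ofNat, Nat.sub_self, Nat.sub_zero,
          Nat.reduceSub, Nat.reduceAdd, Nat.cast_zero, Nat.cast_add, pow_zero, pow_one, one_mul, mul_one,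
          integral_model_weight_Ioc]
        ring
      · have hl1 : 1 ≤ 1 + Real.log y := by linarith [Real.log_nonneg hy]
        have hpw : (1 + Real.log y) ^ (0 + 2 + 1) ≤ (1 + Real.log y) ^ 3 := pow_le_pow_right₀ hl1 (by norm_num)
        refine le_trans (le_of_eq ?_) (((ht₀₂ y hy).trans (mul_le_mul_of_nonneg_right e₀₂ (pow_nonneg (by linarith) _))).trans
          (mul_le_mul_of_nonneg_left hpw hC₀0))
        congr 1
        simp only [Finset.sum_range_succ, Finset.sum_range_zero, zero_add, add_zero, Nat.choose_self,
          Nat.choose_zero_right, Nat.choose_one_right, Nat.cast_one, Nat.cast_ofNat, Nat.sub_self, Nat.sub_zero,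
          Nat.reduceSub, Nat.reduceAdd, Nat.cast_zero, Nat.cast_add, pow_zero, pow_one, one_mul, mul_one,
          integral_model_weight_Ioc]
        ring
    · refine ⟨fun y hy0 hy1 ↦ ?_, fun y hy ↦ ?_⟩
      · refine le_trans (le_of_eq ?_) ((hs₂₀ y hy0 hy1).trans (mul_le_mul_of_nonneg_right e₂₀ (Real.sqrt_nonneg y)))
        congr 1
        simp only [Finset.sum_range_succ, Finset.sum_range_zero, zero_add, add_zero, Nat.choose_self,
          Nat.choose_zero_right, Nat.choose_one_right, Nat.cast_one, Nat.cast_ofNat, Nat.sub_self, Nat.sub_zero,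
          Nat.reduceSub, Nat.reduceAdd, Nat.cast_zero, Nat.cast_add, pow_zero, pow_one, one_mul, mul_one,
          integral_model_weight_Ioc]
        ring
      · have hl1 : 1 ≤ 1 + Real.log y := by linarith [Real.log_nonneg hy]
        have hpw : (1 + Real.log y) ^ (2 + 0 + 1) ≤ (1 + Real.log y) ^ 3 := pow_le_pow_right₀ hl1 (by norm_num)
        refine le_trans (le_of_eq ?_) (((ht₂₀ y hy).trans (mul_le_mul_of_nonneg_right e₂₀ (pow_nonneg (by linarith) _))).trans
          (mul_le_mul_of_nonneg_left hpw hC₀0))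
        congr 1
        simp only [Finset.sum_range_succ, Finset.sum_range_zero, zero_add, add_zero, Nat.choose_self,
          Nat.choose_zero_right, Nat.choose_one_right, Nat.cast_one, Nat.cast_ofNat, Nat.sub_self, Nat.sub_zero,
          Nat.reduceSub, Nat.reduceAdd, Nat.cast_zero, Nat.cast_add, pow_zero, pow_one, one_mul, mul_one,
          integral_model_weight_Ioc]
        ring
    · refine ⟨fun y hy0 hy1 ↦ ?_, fun y hy ↦ ?_⟩
      · refine le_trans (le_of_eq ?_) ((hs₁₁ y hy0 hy1).trans (mul_le_mul_of_nonneg_right e₁₁ (Real.sqrt_nonneg y)))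
        congr 1
        simp only [Finset.sum_range_succ, Finset.sum_range_zero, zero_add, add_zero, Nat.choose_self,
          Nat.choose_zero_right, Nat.cast_one, Nat.sub_self, Nat.sub_zero, Nat.reduceAdd, Nat.cast_zero,
          Nat.cast_add, pow_zero, pow_one, one_mul, mul_one, integral_model_weight_Ioc]
        ring
      · have hl1 : 1 ≤ 1 + Real.log y := by linarith [Real.log_nonneg hy]
        have hpw : (1 + Real.log y) ^ (1 + 1 + 1) ≤ (1 + Real.log y) ^ 3 := pow_le_pow_right₀ hl1 (by norm_num)
        refine le_trans (le_of_eq ?_) (((ht₁₁ y hy).trans (mul_le_mul_of_nonneg_right e₁₁ (pow_nonneg (by linarith) _))).trans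
          (mul_le_mul_of_nonneg_left hpw hC₀0))
        congr 1
        simp only [Finset.sum_range_succ, Finset.sum_range_zero, zero_add, add_zero, Nat.choose_self,
          Nat.choose_zero_right, Nat.cast_one, Nat.sub_self, Nat.sub_zero, Nat.reduceAdd, Nat.cast_zero,
          Nat.cast_add, pow_zero, pow_one, one_mul, mul_one, integral_model_weight_Ioc]
        ring

end Summit.Parity.GeneralizedHardyLittlewood.Theorems.MomentsBeyondDiagonal.DiagCorner

end
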